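import Summits.QuantumFields.YangMills.Theorems.UnitScaleTiltProp7LinAvgOnto
import Literature.MathematicalPhysics.QuantumFieldTheory.Balaban1983to89.BlockAveragingHaarAC
import HarnessLib

/-!
# Route `UnitScaleTilt`, crux K1 «MinimiserStabilityRegPr» (stmt-QuantumFields-19200), stubs `stub_prop8` (V2) ∕ `stub_prop7From14` (V3) — sub-lemma C ∕ D1c, FLAT, k-FOLD:
# **A k-UNIFORM RIGHT INVERSE OF THE TRUE k-FOLD LINEARISED (0.4)-CONSTRAINT AT THE FLAT BACKGROUND, WITH CONSTANT ONE**
# (`exists_rightInverse_iterLin`)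

Cell `ym3-torus` ∕ fleet seat `ym-ust-19200-p2` g4.  [Balaban1985Variational] (45)–(46): «L^jη Q_j H B = B, |HB| ≦ B₀(L^jη)⁻¹|B| with B₀ independent of
k».  For the family's (0.4) averaging, the linearised k-fold constraint at the flat background is the composite `Q^{(k)} = Q₁∘⋯∘Q₁` of the one-step
`linAvg = L·bondAvg − d(combMean)` (p482040, `linAvg_eq_bondAvg_sub_grad_combMean`; k-fold: `…Prop7IterLinearisationFlat`).  THIS FILE: the far-face
crossing field `faceField` of [Balaban1984PropagatorsI] (1.12) (`B5Eq112RenormTransf.faceField`, tree) is INVISIBLE to the combs of (0.3) — along a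
staircase from a block centre no bond sits on the far face in its own direction (`val_mod_ne_of_mem_walk_stairWord`), so `combMean (faceField B) = 0` and
`Q₁(faceField B) = L·bondAvg(faceField B) = L·B` EXACTLY (`linAvg_faceField`; p1 g3's `linAvg_rightInverse` carried the comb correction `d(combMean∘blockOf)`
generically and paid the sup bound `1 + 2(d+2)L`).  Hence the one-step right inverse `Y = faceField(L⁻¹B)` with `sup‖Y‖ ≤ sup‖B‖` — constant ONE — and,
by induction over the levels, for every `k ≤ m + K` and every level-`k` bond field `B` a finest-lattice field `Y` with `Q^{(k)}Y = B` and `sup‖Y‖ ≤ sup‖B‖`: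
(45)–(46) for the TRUE k-fold linearised constraint, `B₀ = 1`, uniformly in `k`, `L`, `d` and the volume (the `L^k` of print's normalisation is built into
`Q^{(k)}`).  `Q^{(k)}` is characterised (`Q 0 = id`, `Q (i+1) = linAvg ∘ Q i`), not defined.  Sorry-free, no definition. [folklore] ∕ cited.
References: T. Bałaban, CMP 102 (1985) 277–309 [Balaban1985Variational] ((45)–(46) p.287, (156) p.302); CMP 95 (1984) 17–40 [Balaban1984PropagatorsI]
((1.11)–(1.12) p.19); CMP 98 (1985) 17–51 [Balaban1985Averaging] ((124)–(125) p.36); CMP 109 (1987) 249–301 [Balaban1987RG1] ((0.3)–(0.4) p.252).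
-/

noncomputable section

open scoped BigOperators Matrix.Norms.L2Operator Matrix
open Function

namespace Summit.QuantumFields.YangMills.Theorems.Prop7AvgLinearisation

open Literature.MathematicalPhysics.QuantumFieldTheory.Balaban1983to89
open T4Continuum AveragingRT BlockAveraging BlockAveragingHaarAC BlockAveragingEMLLinearised
open LatticeFieldCalculus B5Eq112RenormTransf
open Summit.QuantumFields.YangMills.Theorems.Prop7LinAvgOnto (linAvg_add)

variable {P : Params} {j : ℕ}

/-! ## §1 Staircases never meet far-face bonds -/

/-- **ALONG A STAIRCASE OF (0.3) FROM A BLOCK CENTRE, NO BOND SITS ON THE FAR FACE IN ITS OWN DIRECTION**: for every step `s` of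
`walk (emb y) (Γ^σ_{y→x})` (offsets `|n_ν| ≤ (L−1)/2`), the source of its bond has label `≢ L − 1 (mod L)` in the bond's direction (its in-block offset in that
direction is at most `L − 2`). [cite: Balaban1987RG1, (0.3) p.252] -/
theorem val_mod_ne_of_mem_walk_stairWord (hj : j + 1 ≤ P.m + P.K) (y : Site P (j + 1)) (σ : Equiv.Perm (Fin P.d)) (r : Fin P.d → Fin P.L)
    {s : LStep P j} (hs : s ∈ walk (emb y) (stairWord σ (off r))) : (s.bond.src s.bond.dir).val % P.L ≠ P.L - 1 := by
  obtain ⟨k₁, k₂, h1, h2⟩ := exists_take_of_mem_walk _ _ s hs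
  set ν := s.bond.dir with hν
  have hb1 := netDisp_take_stairWord σ (off r) ν k₁
  have hb2 := netDisp_take_stairWord σ (off r) ν k₂
  have hn := off_bounds r ν
  have hL := two_mul_half_add_one P
  have hL1 : 1 < P.L := P.hL.2
  have h2ν := h2 ν
  rw [if_pos rfl] at h2ν
  set t₁ : ℤ := netDisp ((stairWord σ (off r)).take k₁) ν with ht₁
  set hh : ℕ := (P.L - 1) / 2 with hhh
  -- the in-block offset `hh + t₁ ∈ [0, L − 2]`
  have hlo : 0 ≤ (hh : ℤ) + t₁ := by
    have : min 0 (off r ν) ≤ t₁ := hb1.1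
    have := min_le_iff.mp (le_refl (min 0 (off r ν)))
    rcases le_total 0 (off r ν) with h0 | h0
    · rw [min_eq_left h0] at hb1; omega
    · rw [min_eq_right h0] at hb1; omega
  have hhi : (hh : ℤ) + t₁ ≤ (P.L : ℤ) - 2 := by
    have hk2 : netDisp ((stairWord σ (off r)).take k₂) ν ≤ max 0 (off r ν) := hb2.2
    rcases le_total 0 (off r ν) with h0 | h0
    · rw [max_eq_right h0] at hk2; omega
    · rw [max_eq_left h0] at hk2; omega
  obtain ⟨u, hu⟩ : ∃ u : ℕ, (u : ℤ) = (hh : ℤ) + t₁ := ⟨((hh : ℤ) + t₁).toNat, Int.toNat_of_nonneg hlo⟩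
  have hu2 : u + 2 ≤ P.L := by omega
  -- the label of the source in direction `ν`
  have hsrc : s.bond.src ν = (((y ν).val * P.L + u : ℕ) : ZMod (P.sitesPerDir j)) := by
    rw [h1 ν]
    show (((y ν).val * P.L + (P.L - 1) / 2 : ℕ) : ZMod (P.sitesPerDir j)) + ((t₁ : ℤ) : ZMod (P.sitesPerDir j)) = _
    have ht : t₁ = (u : ℤ) - (hh : ℤ) := by omega
    rw [ht, ← hhh]
    push_cast
    ring
  have hlt : (y ν).val * P.L + u < P.sitesPerDir j := by
    have hy : (y ν).val + 1 ≤ P.sitesPerDir (j + 1) := ZMod.val_lt (y ν)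
    have h3 : ((y ν).val + 1) * P.L ≤ P.sitesPerDir (j + 1) * P.L := Nat.mul_le_mul_right _ hy
    rw [P.sitesPerDir_eq_mul_succ hj]
    rw [Nat.add_mul, one_mul] at h3
    omega
  have hval : (s.bond.src ν).val = (y ν).val * P.L + u := by
    rw [hsrc, ZMod.val_natCast, Nat.mod_eq_of_lt hlt]
  rw [hval, Nat.mul_comm, Nat.mul_add_mod, Nat.mod_eq_of_lt (by omega)]
  omega

/-- A signed sum along a walk all of whose bonds carry `0` vanishes. [folklore] -/
theorem walkSum_eq_zero_of_forall {V : Type*} [AddCommGroup V] (Y : PBond P j → V) :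
    ∀ γ : List (LStep P j), (∀ s ∈ γ, Y s.bond = 0) → walkSum Y γ = 0
  | [], _ => by simp [walkSum]
  | s :: γ, h => by
    rw [walkSum_cons, walkSum_eq_zero_of_forall Y γ fun s' hs' => h s' (List.mem_cons_of_mem _ hs'),
      h s List.mem_cons_self]
    simp

/-! ## §2 The far-face field is invisible to the combs: `Q₁(faceField B) = L·B` exactly -/

section FaceField

variable {n : Type*} [Fintype n] [DecidableEq n] [Nonempty n]

omit [Fintype n] [DecidableEq n] [Nonempty n] in
/-- **THE COMB MEAN OF THE FAR-FACE FIELD VANISHES**: `λ̄_{faceField B}(y) = 0` for every block `y`. [cite: Balaban1985Averaging, (62) p.28] -/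
theorem combMean_faceField (hj : j + 1 ≤ P.m + P.K) (B : PBond P (j + 1) → Matrix n n ℂ) (y : Site P (j + 1)) :
    combMean (faceField B) y = 0 := by
  rw [combMean_def]
  have hterm : ∀ i : Idx P, walkSum (faceField B) (walk (emb y) (stairWord i.2.1 (off i.1))) = 0 := by
    intro i
    refine walkSum_eq_zero_of_forall _ _ fun s hs => ?_
    have hne := val_mod_ne_of_mem_walk_stairWord hj y i.2.1 i.1 hs
    cases hb : s.bond with
    | mk src dir =>
      rw [hb] at hne
      simp only [faceField, if_neg hne]
  simp only [hterm, Finset.sum_const_zero, smul_zero]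

omit [Fintype n] [DecidableEq n] [Nonempty n] in
/-- **`Q₁(faceField B) = L·B` EXACTLY** for the linearised one-step (0.4) average (`linAvg_eq_bondAvg_sub_grad_combMean`, `bondAvg_faceField`,
`combMean_faceField`). [cite: Balaban1985Averaging, (124)-(125) p.36; Balaban1984PropagatorsI, (1.11)-(1.12) p.19] -/
theorem linAvg_faceField (hj : j + 1 ≤ P.m + P.K) (B : PBond P (j + 1) → Matrix n n ℂ) (c : PBond P (j + 1)) :
    linAvg (faceField B) c = ((P.L : ℕ) : ℂ) • B c := by
  rw [linAvg_eq_bondAvg_sub_grad_combMean, bondAvg_faceField hj, combMean_faceField hj, combMean_faceField hj, sub_self, sub_zero]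

omit [Fintype n] [DecidableEq n] [Nonempty n] in
/-- **THE ONE-STEP RIGHT INVERSE WITH CONSTANT ONE**: `Q₁(faceField(L⁻¹B)) = B`. [cite: Balaban1985Variational, (45) p.287] -/
theorem linAvg_faceField_inv (hj : j + 1 ≤ P.m + P.K) (B : PBond P (j + 1) → Matrix n n ℂ) (c : PBond P (j + 1)) :
    linAvg (faceField (fun c' => ((P.L : ℝ)⁻¹) • B c')) c = B c := by
  rw [linAvg_faceField hj]
  have hL : (P.L : ℝ) ≠ 0 := Nat.cast_ne_zero.mpr P.L_pos.ne'
  rw [show ((P.L : ℕ) : ℂ) = ((P.L : ℝ) : ℂ) by push_cast; rfl, ← Complex.coe_smul, smul_smul,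
    show ((P.L : ℝ) : ℂ) * (((P.L : ℝ)⁻¹ : ℝ) : ℂ) = 1 by rw [← Complex.ofReal_mul, mul_inv_cancel₀ hL]; simp, one_smul]

omit [Nonempty n] in
/-- Its sup bound: `‖faceField(L⁻¹B)(b)‖ ≤ sup‖B‖` (the field carries `B(c)` on the crossing bonds of `c` and `0` elsewhere).
[cite: Balaban1985Variational, (46) p.287] -/
theorem norm_faceField_inv_le (B : PBond P (j + 1) → Matrix n n ℂ) {M : ℝ} (hM : 0 ≤ M) (hB : ∀ c, ‖B c‖ ≤ M) (b : PBond P j) :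
    ‖faceField (fun c' => ((P.L : ℝ)⁻¹) • B c') b‖ ≤ M := by
  have hL : (P.L : ℝ) ≠ 0 := Nat.cast_ne_zero.mpr P.L_pos.ne'
  unfold faceField
  split_ifs
  · rw [smul_smul, mul_inv_cancel₀ hL, one_smul]
    exact hB _
  · rw [norm_zero]; exact hM

/-! ## §3 The k-fold right inverse, uniformly in k -/

omit [Nonempty n] in
/-- **A k-UNIFORM RIGHT INVERSE OF THE TRUE k-FOLD LINEARISED (0.4)-CONSTRAINT, CONSTANT ONE.**  Let `Q^{(i)}` be any family with `Q^{(0)}Y = Y` and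
`Q^{(i+1)}Y = Q₁(Q^{(i)}Y)`.  For every `k ≤ m + K`, every level-`k` bond field `B` and every `M ≥ 0` with `‖B(c)‖ ≤ M` for all `c`, there is a finest-lattice
bond field `Y` with `Q^{(k)}Y = B` and `‖Y(b)‖ ≤ M` for all `b` — [Balaban1985Variational] (45)–(46) for the family's averaging at the flat background with
`B₀ = 1`, uniformly in `k`, `L`, `d` and the volume. [cite: Balaban1985Variational, (45)-(46) p.287] -/
theorem exists_rightInverse_iterLin
    (Q : (i : ℕ) → (PBond P 0 → Matrix n n ℂ) → PBond P i → Matrix n n ℂ)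
    (hQ0 : ∀ Y, Q 0 Y = Y) (hQs : ∀ (i : ℕ) (Y : PBond P 0 → Matrix n n ℂ) (c : PBond P (i + 1)), Q (i + 1) Y c = linAvg (Q i Y) c) :
    ∀ k : ℕ, k ≤ P.m + P.K → ∀ (B : PBond P k → Matrix n n ℂ) (M : ℝ), 0 ≤ M → (∀ c, ‖B c‖ ≤ M) →
      ∃ Y : PBond P 0 → Matrix n n ℂ, (∀ c : PBond P k, Q k Y c = B c) ∧ ∀ b : PBond P 0, ‖Y b‖ ≤ M := by
  intro k
  induction k with
  | zero =>
    intro _ B M _ hB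
    exact ⟨B, fun c => by rw [hQ0], hB⟩
  | succ k ih =>
    intro hk B M hM hB
    -- the one-step right inverse at level `k`, then the induction hypothesis
    set X : PBond P k → Matrix n n ℂ := faceField (fun c' => ((P.L : ℝ)⁻¹) • B c') with hX
    have hXB : ∀ c, linAvg X c = B c := fun c => linAvg_faceField_inv hk B c
    have hXM : ∀ c, ‖X c‖ ≤ M := fun c => norm_faceField_inv_le B hM hB c
    obtain ⟨Y, hYX, hYM⟩ := ih (Nat.le_of_succ_le hk) X M hM hXM
    refine ⟨Y, fun c => ?_, hYM⟩
    rw [hQs, show Q k Y = X from funext hYX, hXB]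

end FaceField

end Summit.QuantumFields.YangMills.Theorems.Prop7AvgLinearisation

end
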